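import Summits.Schanuel.Schanuel.Theorems.RootDecomp1KSectorTheorem02

/-!
# RootDecomp1KSectorTheorem — lens 1, generation 67, NODE 27 «THE SECTOR THEOREM BY ONE NEWTON STEP AT (∞,∞) — THE EDGE ENGINE» — FORK (B): the FIRST-ORDER SECTOR THEOREM at FLOOR F (`thinFibreAt_of_sectorCond : c k ≠ 0 → DomZero k c → SectorCond m₀ k c → ThinFibreAt m₀ (xPolyP k c)`, every m₀ / k / monomial support, the only escape the typed residue `Residue m₀ k c`; one PROVED Diophantine input `Ridout.padicRoth_int`; CLAIM L3031, PRICE L3032, ADDENDUM L3037, RULE K-R58, NODE L3047, VERDICT L3050) — continuation (RootDecomp1KSectorTheorem03): §4b  ONE CONSTANT CORRECTION ABSORBED: the refined distance to a SIMPLE root · §5  The archimedean exclusion of a FIXED rescaled value — 12 declarations `layered_bound` … `tendsto_partialSum_two`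

(lens-1 g67 NODE 27 «THE SECTOR THEOREM BY ONE NEWTON STEP AT (∞,∞) — THE EDGE ENGINE» L3047: HOME kernel K = HOME/decomp-schanuel-lens-1/g67/lean/SectorTheorem.lean sha256 bbe43d14…, 2869 l, ONE namespace `Summit.Schanuel.Schanuel.Theorems.RootDecomp1KSectorTheorem`, imports the tree port …RootDecomp1KDigitPincer03 ONLY (node 26's record port; its closure holds every cell file used); no private / instance / set_option / notation / sorry / new axiom / binder / `decide` on levels; lens farm rc 0 · 0 errors · 0 sorries · warnings dupNamespace only, `--axioms` standard on the 18 deciding declarations, Probe rc 0 (g67/out/); memo g67/NODE-g67.md; CLAIM L3031 (ASK-FIRST under K-R57 (iii)); crit g12 PRICE L3032 (fork (A) ×0-AS-RECORD as posted / fork (B) a kernel meeting FLOOR F = «FIRST-ORDER SECTOR THEOREM» = THEOREM ×1 consuming K-R57 (iii); CHECKLIST K-g67 F1–F6 + S1–S8; RULE K-R58 PRE-ANNOUNCED) and PRICE ADDENDUM L3037 ((F6′) `W4P` by tree name; the ρ3 specimen `x² + x·Y² + Y⁵ + 3` of writer NOTE 17 L3036 = the F5 exhibit); census instruments LIVENESS-v36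 (key edge) / v37 (key ls2); crit g12 VERDICT L3050 (2026-09-02T03:35Z): THEOREM ×1 GRANTED under K-R57 (iii) for FORK (B) = the FIRST-ORDER SECTOR THEOREM AT FLOOR F (F1 F2 F3 (T) F4(α) F4(β) F5 F6 F6′ R-27-i and CHECKLIST S1–S8 met on the critic's own farm runs), the single ×1 of the sector line CONSUMED (K-R58 (i): no further ×1 on this line), TALLY lens-1 ×22 + THEOREM ×24, RULE K-R58 FIXED (PRICE L3032 (i)–(v) verbatim with the ADDENDUM L3037 gloss; W-27-2 = a ×0 wish for typed stratum predicates), PORT GO → census-1 (this port; PORT IDENTITY 27 owed by the seated critic). Port by census-1 gen 25 as `RootDecomp1KSectorTheorem01–10` (files ≤ 400 lines; `--supports stmt-Schanuel-33364`, the item stays OPEN; no census credit carried; RULE K-R58 (iv): UNCONDITIONAL PART ∪= these names): 01 = K l.1–307 of the prepped source (opens §1 / §2 / §3) — 20 decls `dMax`, `box`, `supp`, …, `two_zpow_inj`; 02 = K l.308–570 of the prepped source (opens §4) — 5 decls `far_pair`, `natDegree_le_dMax`, `norm_pow_sub_one_le`, …, `mem_supp`; 03 = K l.571–896 of the prepped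 source (opens §4b / §5) — 12 decls `layered_bound`, `edge_bound_one`, `edge_bound_crude`, …, `tendsto_partialSum_two`; 04 = K l.897–1221 of the prepped source (opens §6 / §7) — 10 decls `arch_finite`, `ridout_two`, `lt_rpow_neg_of_pow_mul_pow_lt`, …, `factorial_pred_le_div`; 05 = K l.1222–1500 of the prepped source (opens §8) — 4 decls `pair_levels_finite`, `dvd_lc_pow_val`, `den_le_of_dvd`, `den_rescaled_le`; 06 = K l.1501–1822 of the prepped source (opens §9) — 13 decls `size_regime`, `c_zero_ne_zero`, `far_levels_finite`, …, `sum_range_ite_shift`; 07 = K l.1823–2080 of the prepped source (inside §9) — 14 decls `layerPoly_lin2`, `layer0_lin2`, `layer1_lin2`, …, `natDegree_scaleShift`; 08 = K l.2081–2401 of the prepped source (opens §10) — 18 decls `thinFibreAt_xLinear`, `thinFibreAt_xPolyP_one`, `edgeGood_of_gap`, …, `thinFibreAt_M_sector`; 09 = K l.2402–2627 of the prepped source (opens §11) — 17 decls `sectorCond_beta0_example`, `thinFibreAt_beta0_example`, `thinFibreAt_generic_xLinear_example`, …, `rho2_two`; 10 = K l.2628–2905 of the prepped source (opens §12) — 13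 decls `residue_rho2`, `rho3`, `rho3_zero`, …, `W4P_eq`. 39 one-line docstrings synthesised for undocumented helper declarations (statements quoted, census port convention since gen 22); everything else = K VERBATIM (statements, names, proofs, K's module docstring kept in part 01 below this provenance block).)
-/

noncomputable section

namespace Summit.Schanuel.Schanuel.Theorems.RootDecomp1KSectorTheorem

open Polynomial LiouvilleNumber
open scoped Nat
open Summit.Schanuel.Schanuel.Theorems.RootDecomp1KTwoBaseCell (psNumer partialSum_eq_psNumer_div coprime_psNumer)
open Summit.Schanuel.Schanuel.Theorems.RootDecomp1KRelLiouvilleCell (partialSum_two_strictMono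
  abs_liouvilleNumber_two_sub_partialSum)
open Summit.Schanuel.Schanuel.Theorems.RootDecomp1KDegreeLadder
open Summit.Schanuel.Schanuel.Theorems.RootDecomp1KXLinear (xLinP bev_xLinP norm_ratCast_two norm_ratCast_of_le
  norm_psNumer_sub_one)
open Summit.Schanuel.Schanuel.Theorems.RootDecomp1KDigitPincer (xc XP X6P)
open Summit.Schanuel.Schanuel.Theorems.RootDecomp1KOddEmpty (W4P w4C vG natDegree_vG)
open Summit.Schanuel.Schanuel.Theorems.RootDecomp1KHyperellipticSiegel (mQ mC mC_zero mC_one mC_two natDegree_mQ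
  coeff_mQ_five leadingCoeff_mQ)
open Summit.Schanuel.Schanuel.Theorems.RootDecomp1KXLinearII (norm_aeval_le norm_psNumer)
open Summit.Schanuel.Schanuel.Theorems.RootDecomp1KXTop
open Summit.Schanuel.Schanuel.Theorems.RootDecomp1KXAll
open Summit.Schanuel.Schanuel.Theorems.RootDecomp1KLevelFinite
open Summit.Schanuel.Schanuel.Theorems.RootDecomp1KLocalExponent
open Summit.Schanuel.Schanuel.Theorems.RootDecomp1KIntegrality

/-- **THE LAYERED EDGE BOUND (one Newton step at `(∞,∞)`, all depths).**  If `M` is the top weight of the slope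
`s/q`, `N! = q·n`, `N ≥ 3`, and `W/2^{s·n}` is a point of level `N`, then for every depth `L`
`‖Σ_{g<L} 2^{n·g} · f_g(W)‖₂ ≤ max(1,‖W‖₂)^{D} · ((1/2)^{L·n} + (1/2)^{N! − (N−1)!})`:
the weight-normalised level identity, the monomials of depth `≥ L` cost `2^{−L·n}`, and `p_N ≡ 1 (mod 2^{N!−(N−1)!})`
replaces `p_N^j` by `1` in the top layers (the DIGIT ceiling). -/
theorem layered_bound (k : ℕ) (c : ℕ → ℤ[X]) {s q M : ℕ} (hT : TopWeight k c s q M) (L : ℕ) {N n : ℕ}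
    (hN : 3 ≤ N) (hn : N ! = q * n) {r W : ℚ} (hrW : W = r * 2 ^ (s * n))
    (hW : bev (xPolyP k c) (partialSum 2 N) r = 0) :
    ‖∑ g ∈ Finset.range L, (2 : PadicAlgCl 2) ^ (n * g) * aeval (W : PadicAlgCl 2) (layerPoly k c s q M g)‖ ≤
      (max 1 ‖(W : PadicAlgCl 2)‖) ^ dMax k c *
        ((1 / 2 : ℝ) ^ (L * n) + (1 / 2 : ℝ) ^ (Nat.factorial N - Nat.factorial (N - 1))) := by
  classical
  obtain ⟨hwt, hf0⟩ := hT
  set D : ℕ := dMax k c with hDdef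
  set u : PadicAlgCl 2 := (psNumer 2 N : PadicAlgCl 2) with hudef
  have hu1 : ‖u‖ = 1 := norm_psNumer hN
  have hWr : (W : PadicAlgCl 2) = (r : PadicAlgCl 2) * 2 ^ (s * n) := by rw [hrW]; push_cast; ring
  set B : ℝ := (max 1 ‖(W : PadicAlgCl 2)‖) ^ D with hBdef
  have hB1 : (1 : ℝ) ≤ max 1 ‖(W : PadicAlgCl 2)‖ := le_max_left _ _
  have hBge : ∀ i, i ≤ D → ‖(W : PadicAlgCl 2)‖ ^ i ≤ B := by
    intro i hi
    calc ‖(W : PadicAlgCl 2)‖ ^ i ≤ (max 1 ‖(W : PadicAlgCl 2)‖) ^ i :=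
          pow_le_pow_left₀ (norm_nonneg _) (le_max_right _ _) i
      _ ≤ B := pow_le_pow_right₀ hB1 hi
  have hB0 : 0 ≤ B := by positivity
  have hhalf : ∀ m : ℕ, ‖(2 : PadicAlgCl 2) ^ m‖ = (1 / 2 : ℝ) ^ m := norm_two_pow_Cp
  have hhalf1 : ∀ m : ℕ, ‖(2 : PadicAlgCl 2) ^ m‖ ≤ 1 := fun m => by
    rw [hhalf]; exact pow_le_one₀ (by norm_num) (by norm_num)
  -- the exponents and the terms of the weight-normalised identity
  set ex : ℕ × ℕ → ℕ := fun p => (k - p.1) * N ! + s * n * (D - p.2) with hexdef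
  have hexwt : ∀ p ∈ box k c, ex p + n * (q * p.1 + s * p.2) = n * (q * k + s * D) := by
    intro p hp
    simp only [box, Finset.mem_product, Finset.mem_range] at hp
    have hj : p.1 ≤ k := by omega
    have hi : p.2 ≤ D := by omega
    simp only [hexdef, hn]
    zify [hj, hi]
    ring
  set gt : ℕ × ℕ → PadicAlgCl 2 := fun p =>
    u ^ p.1 * ((c p.1).coeff p.2 : PadicAlgCl 2) * (W : PadicAlgCl 2) ^ p.2 * 2 ^ ex p with hgtdef
  -- the identity: `Σ_{box} gt = 0`
  have hcoef : ∀ j ∈ Finset.range (k + 1), aeval (r : PadicAlgCl 2) (c j) =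
      ∑ i ∈ Finset.range (D + 1), ((c j).coeff i : PadicAlgCl 2) * (r : PadicAlgCl 2) ^ i := by
    intro j hj
    have hjk : j ≤ k := by have := Finset.mem_range.mp hj; omega
    rw [aeval_eq_sum_range' (Nat.lt_succ_of_le (natDegree_le_dMax c hjk))]
    refine Finset.sum_congr rfl fun i _ => ?_
    rw [zsmul_eq_mul]
  have hgsum : ∑ p ∈ box k c, gt p = 0 := by
    have h0 := level_identity_sum k c N r hW
    have h1 : ∑ p ∈ box k c, gt p =
        2 ^ (s * n * D) * ∑ j ∈ Finset.range (k + 1), u ^ j * 2 ^ ((k - j) * N !) * aeval (r : PadicAlgCl 2) (c j) := by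
      rw [box, Finset.sum_product, Finset.mul_sum]
      refine Finset.sum_congr rfl fun j hj => ?_
      rw [hcoef j hj, Finset.mul_sum, Finset.mul_sum]
      refine Finset.sum_congr rfl fun i hi => ?_
      have hiD : i ≤ D := by have := Finset.mem_range.mp hi; omega
      have hexp : s * n * i + ex (j, i) = (k - j) * N ! + s * n * D := by
        simp only [hexdef]; zify [hiD]; ring
      simp only [hgtdef, hWr, mul_pow, ← pow_mul]
      rw [show (2 : PadicAlgCl 2) ^ (s * n * D) * (u ^ j * 2 ^ ((k - j) * N !) *
          (((c j).coeff i : PadicAlgCl 2) * (r : PadicAlgCl 2) ^ i)) =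
          u ^ j * ((c j).coeff i : PadicAlgCl 2) * (r : PadicAlgCl 2) ^ i * 2 ^ ((k - j) * N ! + s * n * D) by ring,
        ← hexp, pow_add]
      ring
    rw [h1, h0, mul_zero]
  have hgsupp : ∑ p ∈ supp k c, gt p = 0 := by
    rw [supp, Finset.sum_filter_of_ne, hgsum]
    intro p _ hne hcp
    apply hne
    simp only [hgtdef, hcp, Int.cast_zero, mul_zero, zero_mul]
  -- split the support into the top layers and the deep part
  set top := (supp k c).filter (fun p => M < (q * p.1 + s * p.2) + L) with htop
  set deep := (supp k c).filter (fun p => ¬ M < (q * p.1 + s * p.2) + L) with hdeep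
  have hsplit : ∑ p ∈ top, gt p + ∑ p ∈ deep, gt p = 0 := by
    rw [htop, hdeep, Finset.sum_filter_add_sum_filter_not, hgsupp]
  -- an edge point exists (the edge polynomial is non-zero)
  have hex_edge : ∃ p₀, p₀ ∈ (supp k c).filter (fun p => q * p.1 + s * p.2 + 0 = M) := by
    by_contra hne
    push Not at hne
    apply hf0
    rw [layerPoly, Finset.eq_empty_of_forall_notMem hne, Finset.sum_empty]
  obtain ⟨p₀, hp₀⟩ := hex_edge
  have hp₀supp : p₀ ∈ supp k c := (Finset.mem_filter.mp hp₀).1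
  have hp₀box : p₀ ∈ box k c := (Finset.mem_filter.mp hp₀supp).1
  have hp₀wt : (q * p₀.1 + s * p₀.2) = M := by have := (Finset.mem_filter.mp hp₀).2; omega
  set e₀ : ℕ := ex p₀ with he₀
  have hTOT : e₀ + n * M = n * (q * k + s * D) := by rw [← hp₀wt]; exact hexwt p₀ hp₀box
  have hex_rel : ∀ p ∈ supp k c, ∀ g', (q * p.1 + s * p.2) + g' = M → ex p = e₀ + n * g' := by
    intro p hp g' hg'
    have h1 := hexwt p (Finset.mem_filter.mp hp).1
    have h3 : n * M = n * (q * p.1 + s * p.2) + n * g' := by rw [← hg', mul_add]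
    linarith
  -- the top sum is `2^{e₀} · F`
  set F : PadicAlgCl 2 := ∑ p ∈ top,
    u ^ p.1 * ((c p.1).coeff p.2 : PadicAlgCl 2) * (W : PadicAlgCl 2) ^ p.2 * 2 ^ (n * (M - (q * p.1 + s * p.2))) with hFdef
  have htop_sum : ∑ p ∈ top, gt p = 2 ^ e₀ * F := by
    rw [hFdef, Finset.mul_sum]
    refine Finset.sum_congr rfl fun p hp => ?_
    have hps : p ∈ supp k c := (Finset.mem_filter.mp hp).1
    have hle : (q * p.1 + s * p.2) ≤ M := hwt p hps
    have hexp : ex p = e₀ + n * (M - (q * p.1 + s * p.2)) := hex_rel p hps (M - (q * p.1 + s * p.2)) (by omega)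
    simp only [hgtdef, hexp, pow_add]; ring
  -- the deep sum is small
  have hdeep_le : ‖∑ p ∈ deep, gt p‖ ≤ B * ((1 / 2 : ℝ) ^ e₀ * (1 / 2 : ℝ) ^ (n * L)) := by
    apply IsUltrametricDist.norm_sum_le_of_forall_le_of_nonneg (by positivity)
    intro p hp
    obtain ⟨hps, hpw⟩ := Finset.mem_filter.mp hp
    obtain ⟨-, hiD, -⟩ := mem_supp hps
    have hle : (q * p.1 + s * p.2) ≤ M := hwt p hps
    have hexp : ex p = e₀ + n * (M - (q * p.1 + s * p.2)) := hex_rel p hps (M - (q * p.1 + s * p.2)) (by omega)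
    have hexge : e₀ + n * L ≤ ex p := by
      rw [hexp]; exact Nat.add_le_add_left (Nat.mul_le_mul_left n (by omega)) _
    simp only [hgtdef]
    rw [norm_mul, norm_mul, norm_mul, norm_pow, hu1, one_pow, one_mul, norm_pow, hhalf]
    have h1 : ‖((c p.1).coeff p.2 : PadicAlgCl 2)‖ ≤ 1 := norm_intCast_le_one_st _
    have h2 : (1 / 2 : ℝ) ^ ex p ≤ (1 / 2 : ℝ) ^ (e₀ + n * L) :=
      pow_le_pow_of_le_one (by norm_num) (by norm_num) hexge
    calc ‖((c p.1).coeff p.2 : PadicAlgCl 2)‖ * ‖(W : PadicAlgCl 2)‖ ^ p.2 * (1 / 2 : ℝ) ^ ex p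
        ≤ 1 * B * (1 / 2 : ℝ) ^ (e₀ + n * L) :=
          mul_le_mul (mul_le_mul h1 (hBge p.2 hiD) (by positivity) zero_le_one) h2 (by positivity)
            (by positivity)
      _ = B * ((1 / 2 : ℝ) ^ e₀ * (1 / 2 : ℝ) ^ (n * L)) := by rw [pow_add]; ring
  -- hence `‖F‖ ≤ B · (1/2)^{nL}`
  have hF_le : ‖F‖ ≤ B * (1 / 2 : ℝ) ^ (n * L) := by
    have h1 : ‖(2 : PadicAlgCl 2) ^ e₀ * F‖ = ‖∑ p ∈ deep, gt p‖ := by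
      rw [← htop_sum, show ∑ p ∈ top, gt p = -∑ p ∈ deep, gt p by
        rw [eq_neg_iff_add_eq_zero]; exact hsplit, norm_neg]
    have h2 : (1 / 2 : ℝ) ^ e₀ * ‖F‖ ≤ (1 / 2 : ℝ) ^ e₀ * (B * (1 / 2 : ℝ) ^ (n * L)) := by
      rw [← hhalf e₀, ← norm_mul, h1, hhalf]
      calc ‖∑ p ∈ deep, gt p‖ ≤ B * ((1 / 2 : ℝ) ^ e₀ * (1 / 2 : ℝ) ^ (n * L)) := hdeep_le
        _ = (1 / 2 : ℝ) ^ e₀ * (B * (1 / 2 : ℝ) ^ (n * L)) := by ring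
    exact le_of_mul_le_mul_left h2 (by positivity)
  -- `F` differs from the un-twisted top sum `F₁` by `p_N^j − 1` factors
  set F₁ : PadicAlgCl 2 := ∑ p ∈ top,
    ((c p.1).coeff p.2 : PadicAlgCl 2) * (W : PadicAlgCl 2) ^ p.2 * 2 ^ (n * (M - (q * p.1 + s * p.2))) with hF₁def
  have hFF₁ : ‖F - F₁‖ ≤ B * (1 / 2 : ℝ) ^ (Nat.factorial N - Nat.factorial (N - 1)) := by
    rw [hFdef, hF₁def, ← Finset.sum_sub_distrib]
    apply IsUltrametricDist.norm_sum_le_of_forall_le_of_nonneg (by positivity)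
    intro p hp
    have hps : p ∈ supp k c := (Finset.mem_filter.mp hp).1
    obtain ⟨-, hiD, -⟩ := mem_supp hps
    rw [show u ^ p.1 * ((c p.1).coeff p.2 : PadicAlgCl 2) * (W : PadicAlgCl 2) ^ p.2 * 2 ^ (n * (M - (q * p.1 + s * p.2))) -
        ((c p.1).coeff p.2 : PadicAlgCl 2) * (W : PadicAlgCl 2) ^ p.2 * 2 ^ (n * (M - (q * p.1 + s * p.2))) =
        (u ^ p.1 - 1) * (((c p.1).coeff p.2 : PadicAlgCl 2) * (W : PadicAlgCl 2) ^ p.2) * 2 ^ (n * (M - (q * p.1 + s * p.2))) by ring,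
      norm_mul, norm_mul, norm_mul, norm_pow]
    have h1 : ‖u ^ p.1 - 1‖ ≤ (1 / 2 : ℝ) ^ (Nat.factorial N - Nat.factorial (N - 1)) :=
      (norm_pow_sub_one_le hu1.le p.1).trans (norm_psNumer_sub_one (by omega))
    have h2 : ‖((c p.1).coeff p.2 : PadicAlgCl 2)‖ * ‖(W : PadicAlgCl 2)‖ ^ p.2 ≤ 1 * B :=
      mul_le_mul (norm_intCast_le_one_st _) (hBge p.2 hiD) (by positivity) zero_le_one
    calc ‖u ^ p.1 - 1‖ * (‖((c p.1).coeff p.2 : PadicAlgCl 2)‖ * ‖(W : PadicAlgCl 2)‖ ^ p.2) *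
          ‖(2 : PadicAlgCl 2) ^ (n * (M - (q * p.1 + s * p.2)))‖
        ≤ (1 / 2 : ℝ) ^ (Nat.factorial N - Nat.factorial (N - 1)) * (1 * B) * 1 :=
          mul_le_mul (mul_le_mul h1 h2 (by positivity) (by positivity)) (hhalf1 _) (by positivity)
            (by positivity)
      _ = B * (1 / 2 : ℝ) ^ (Nat.factorial N - Nat.factorial (N - 1)) := by ring
  -- `F₁` regrouped by depth is the layered sum
  have hF₁eq : F₁ = ∑ g ∈ Finset.range L, (2 : PadicAlgCl 2) ^ (n * g) *
      aeval (W : PadicAlgCl 2) (layerPoly k c s q M g) := by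
    have hmaps : ∀ p ∈ top, M - (q * p.1 + s * p.2) ∈ Finset.range L := by
      intro p hp
      obtain ⟨hps, hpw⟩ := Finset.mem_filter.mp hp
      have := hwt p hps
      rw [Finset.mem_range]; omega
    rw [hF₁def, ← Finset.sum_fiberwise_of_maps_to hmaps]
    refine Finset.sum_congr rfl fun g hg => ?_
    have hgL : g < L := Finset.mem_range.mp hg
    rw [aeval_layerPoly, Finset.mul_sum]
    have hset : top.filter (fun p => M - (q * p.1 + s * p.2) = g) = (supp k c).filter (fun p => q * p.1 + s * p.2 + g = M) := by
      ext p
      simp only [htop, Finset.mem_filter]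
      constructor
      · rintro ⟨⟨hps, hlt⟩, hg'⟩
        have := hwt p hps
        exact ⟨hps, by omega⟩
      · rintro ⟨hps, hg'⟩
        exact ⟨⟨hps, by omega⟩, by omega⟩
    rw [hset]
    refine Finset.sum_congr rfl fun p hp => ?_
    have hg' : q * p.1 + s * p.2 + g = M := (Finset.mem_filter.mp hp).2
    have hMw : M - (q * p.1 + s * p.2) = g := by omega
    rw [hMw]; ring
  -- conclude
  have hfin : F₁ = F + -(F - F₁) := by ring
  rw [← hF₁eq, hfin]
  calc ‖F + -(F - F₁)‖ ≤ max ‖F‖ ‖-(F - F₁)‖ := IsUltrametricDist.norm_add_le_max _ _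
    _ ≤ B * (1 / 2 : ℝ) ^ (n * L) + B * (1 / 2 : ℝ) ^ (Nat.factorial N - Nat.factorial (N - 1)) := by
        rw [norm_neg]
        exact max_le (le_add_of_nonneg_right (by positivity) |>.trans' hF_le)
          (le_add_of_nonneg_left (by positivity) |>.trans' hFF₁)
    _ = B * ((1 / 2 : ℝ) ^ (L * n) + (1 / 2 : ℝ) ^ (Nat.factorial N - Nat.factorial (N - 1))) := by
        rw [mul_comm n L]; ring

/-- the edge case `L = 1` of the layered bound: `‖f(W)‖₂ ≤ max(1,‖W‖₂)^D · ((1/2)^{n} + (1/2)^{N!−(N−1)!})`. -/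
theorem edge_bound_one (k : ℕ) (c : ℕ → ℤ[X]) {s q M : ℕ} (hT : TopWeight k c s q M) {N n : ℕ}
    (hN : 3 ≤ N) (hn : N ! = q * n) {r W : ℚ} (hrW : W = r * 2 ^ (s * n))
    (hW : bev (xPolyP k c) (partialSum 2 N) r = 0) :
    ‖aeval (W : PadicAlgCl 2) (layerPoly k c s q M 0)‖ ≤
      (max 1 ‖(W : PadicAlgCl 2)‖) ^ dMax k c *
        ((1 / 2 : ℝ) ^ (1 * n) + (1 / 2 : ℝ) ^ (Nat.factorial N - Nat.factorial (N - 1))) := by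
  have h := layered_bound k c hT 1 hN hn hrW hW
  rwa [Finset.sum_range_one, mul_zero, pow_zero, one_mul] at h

/-- the crude case of the layered bound: if the layers `f_1, …, f_{L−1}` vanish identically then
`‖f(W)‖₂ ≤ max(1,‖W‖₂)^D · ((1/2)^{L·n} + (1/2)^{N!−(N−1)!})`. -/
theorem edge_bound_crude (k : ℕ) (c : ℕ → ℤ[X]) {s q M L : ℕ} (hT : TopWeight k c s q M) (hL : 1 ≤ L)
    (hlay : ∀ g, 1 ≤ g → g < L → layerPoly k c s q M g = 0) {N n : ℕ}
    (hN : 3 ≤ N) (hn : N ! = q * n) {r W : ℚ} (hrW : W = r * 2 ^ (s * n))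
    (hW : bev (xPolyP k c) (partialSum 2 N) r = 0) :
    ‖aeval (W : PadicAlgCl 2) (layerPoly k c s q M 0)‖ ≤
      (max 1 ‖(W : PadicAlgCl 2)‖) ^ dMax k c *
        ((1 / 2 : ℝ) ^ (L * n) + (1 / 2 : ℝ) ^ (Nat.factorial N - Nat.factorial (N - 1))) := by
  have h := layered_bound k c hT L hN hn hrW hW
  rwa [Finset.sum_eq_single_of_mem 0 (Finset.mem_range.mpr (by omega)), mul_zero, pow_zero, one_mul] at h
  intro g hg hg0
  rw [hlay g (Nat.one_le_iff_ne_zero.mpr hg0) (Finset.mem_range.mp hg), map_zero, mul_zero]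

/-! ## §4b  ONE CONSTANT CORRECTION ABSORBED: the refined distance to a SIMPLE root -/

/-- ultrametric Lipschitz bound for powers. -/
theorem norm_pow_sub_pow_le (W β : PadicAlgCl 2) {R : ℝ} (hW : ‖W‖ ≤ R) (hβ : ‖β‖ ≤ R) (i : ℕ) :
    ‖W ^ i - β ^ i‖ ≤ ‖W - β‖ * (max 1 R) ^ i := by
  induction i with
  | zero => simp
  | succ i ih =>
    have hR1 : R ≤ max 1 R := le_max_right _ _
    have hM1 : (1 : ℝ) ≤ max 1 R := le_max_left _ _
    have hR0 : 0 ≤ R := (norm_nonneg _).trans hW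
    rw [show W ^ (i + 1) - β ^ (i + 1) = W * (W ^ i - β ^ i) + (W - β) * β ^ i by ring]
    calc ‖W * (W ^ i - β ^ i) + (W - β) * β ^ i‖
        ≤ max ‖W * (W ^ i - β ^ i)‖ ‖(W - β) * β ^ i‖ := IsUltrametricDist.norm_add_le_max _ _
      _ ≤ ‖W - β‖ * (max 1 R) ^ (i + 1) := by
          rw [norm_mul, norm_mul, norm_pow]
          refine max_le ?_ ?_
          · calc ‖W‖ * ‖W ^ i - β ^ i‖ ≤ max 1 R * (‖W - β‖ * (max 1 R) ^ i) :=
                  mul_le_mul (hW.trans hR1) ih (norm_nonneg _) (by positivity)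
              _ = ‖W - β‖ * (max 1 R) ^ (i + 1) := by rw [pow_succ]; ring
          · calc ‖W - β‖ * ‖β‖ ^ i ≤ ‖W - β‖ * (max 1 R) ^ i :=
                  mul_le_mul_of_nonneg_left (pow_le_pow_left₀ (norm_nonneg _) (hβ.trans hR1) i) (norm_nonneg _)
              _ ≤ ‖W - β‖ * (max 1 R) ^ (i + 1) :=
                  mul_le_mul_of_nonneg_left (pow_le_pow_right₀ hM1 (Nat.le_succ i)) (norm_nonneg _)

/-- the Lipschitz constant of a `ℂ₂`-polynomial on the ball of radius `R`. -/
def lipC (P : (PadicAlgCl 2)[X]) (R : ℝ) : ℝ :=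
  ∑ i ∈ Finset.range (P.natDegree + 1), ‖P.coeff i‖ * (max 1 R) ^ i

/-- `(P : (PadicAlgCl 2)[X]) (R : ℝ) : 0 ≤ lipC P R`. -/
theorem lipC_nonneg (P : (PadicAlgCl 2)[X]) (R : ℝ) : 0 ≤ lipC P R := by
  unfold lipC; positivity

/-- ultrametric Lipschitz bound for polynomials: `‖P(W) − P(β)‖ ≤ ‖W − β‖ · lipC P R` on the ball of radius `R`. -/
theorem norm_eval_sub_le (P : (PadicAlgCl 2)[X]) {W β : PadicAlgCl 2} {R : ℝ} (hW : ‖W‖ ≤ R) (hβ : ‖β‖ ≤ R) :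
    ‖P.eval W - P.eval β‖ ≤ ‖W - β‖ * lipC P R := by
  rw [eval_eq_sum_range, eval_eq_sum_range, ← Finset.sum_sub_distrib, lipC, Finset.mul_sum]
  refine (norm_sum_le _ _).trans (Finset.sum_le_sum fun i _ => ?_)
  rw [← mul_sub, norm_mul]
  calc ‖P.coeff i‖ * ‖W ^ i - β ^ i‖ ≤ ‖P.coeff i‖ * (‖W - β‖ * (max 1 R) ^ i) :=
        mul_le_mul_of_nonneg_left (norm_pow_sub_pow_le W β hW hβ i) (norm_nonneg _)
    _ = ‖W - β‖ * (‖P.coeff i‖ * (max 1 R) ^ i) := by ring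

/-- `(f : ℤ[X]) (z : PadicAlgCl 2) : aeval z f = (f.map (algebraMap ℤ (PadicAlgCl 2))).eval z`. -/
theorem aeval_eq_eval_map (f : ℤ[X]) (z : PadicAlgCl 2) :
    aeval z f = (f.map (algebraMap ℤ (PadicAlgCl 2))).eval z := by
  rw [eval_map, aeval_def]

/-- **THE REFINED DISTANCE TO A SIMPLE ROOT.**  If `β` is a simple root of `f ∈ ℤ[W]` (`f(β) = 0`, `f'(β) ≠ 0`), then on
the ball `‖W‖ ≤ R`, close to `β`, `‖f(W)‖ = κ · ‖W − β‖` EXACTLY with `κ = ‖(f/(W−β))(β)‖ = ‖f'(β)‖ > 0`. -/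
theorem refined_root (f : ℤ[X]) {β : PadicAlgCl 2} (hroot : aeval β f = 0) (hder : aeval β (derivative f) ≠ 0)
    (R : ℝ) : ∃ κ ρ : ℝ, 0 < κ ∧ 0 < ρ ∧
      ∀ W : PadicAlgCl 2, ‖W‖ ≤ R → ‖W - β‖ < ρ → ‖aeval W f‖ = κ * ‖W - β‖ := by
  set fm := f.map (algebraMap ℤ (PadicAlgCl 2)) with hfm
  have hfroot : fm.IsRoot β := by rw [IsRoot.def, ← aeval_eq_eval_map]; exact hroot
  set g := fm /ₘ (X - Polynomial.C β) with hg
  have hmul : (X - Polynomial.C β) * g = fm := mul_divByMonic_eq_iff_isRoot.mpr hfroot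
  have hgβ : g.eval β = aeval β (derivative f) := by
    rw [aeval_eq_eval_map, ← derivative_map, ← hfm, ← hmul, derivative_mul]
    simp
  set κ : ℝ := ‖g.eval β‖ with hκ
  have hκ0 : 0 < κ := by rw [hκ, hgβ]; exact norm_pos_iff.mpr hder
  set R' : ℝ := max R ‖β‖ with hR'
  set Λ : ℝ := lipC g R' with hΛ
  have hΛ0 : 0 ≤ Λ := lipC_nonneg _ _
  refine ⟨κ, κ / (Λ + 1), hκ0, by positivity, fun W hW hWβ => ?_⟩
  have hdiff : ‖g.eval W - g.eval β‖ < κ := by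
    have h1 := norm_eval_sub_le g (hW.trans (le_max_left _ _)) (le_max_right R ‖β‖)
    have h2 : ‖W - β‖ * Λ ≤ κ / (Λ + 1) * Λ := mul_le_mul_of_nonneg_right hWβ.le hΛ0
    have h3 : κ / (Λ + 1) * Λ < κ := by
      rw [div_mul_eq_mul_div, div_lt_iff₀ (by positivity)]
      nlinarith
    linarith
  have hgW : ‖g.eval W‖ = κ := by
    have hne : ‖g.eval β‖ ≠ ‖g.eval W - g.eval β‖ := by rw [← hκ]; exact (ne_of_lt hdiff).symm
    rw [show g.eval W = g.eval β + (g.eval W - g.eval β) by ring,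
      IsUltrametricDist.norm_add_eq_max_of_norm_ne_norm hne, max_eq_left hdiff.le]
  rw [aeval_eq_eval_map, ← hfm, ← hmul, eval_mul, eval_sub, eval_X, eval_C, norm_mul, hgW, mul_comm]

/-! ## §5  The archimedean exclusion of a FIXED rescaled value -/

/-- `ℓ₂ = Σ 2^{-k!}` is transcendental (Liouville). -/
theorem transcendental_ell2 : Transcendental ℤ (liouvilleNumber 2) := by
  have h := liouville_liouvilleNumber (le_refl 2)
  have h' : Liouville (liouvilleNumber 2) := by simpa using h
  exact h'.transcendental

/-- `(1/2)^t = (2^t)⁻¹`. -/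
theorem half_pow_eq_inv (t : ℕ) : (1 / 2 : ℝ) ^ t = (2 ^ t)⁻¹ := by
  rw [one_div, inv_pow]

/-- `s_N → ℓ₂`. -/
theorem tendsto_partialSum_two :
    Filter.Tendsto (fun N => partialSum 2 N) Filter.atTop (nhds (liouvilleNumber 2)) := by
  rw [Metric.tendsto_atTop]
  intro ε hε
  obtain ⟨m, hm⟩ := exists_pow_lt_of_lt_one (half_pos hε) (by norm_num : (1 / 2 : ℝ) < 1)
  refine ⟨m, fun N hN => ?_⟩
  rw [Real.dist_eq, abs_sub_comm]
  have h1 := abs_liouvilleNumber_two_sub_partialSum N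
  have h2 : (2 : ℝ) / 2 ^ (N + 1)! = 2 * (1 / 2 : ℝ) ^ (N + 1)! := by
    rw [half_pow_eq_inv, div_eq_mul_inv]
  have h3 : (1 / 2 : ℝ) ^ (N + 1)! ≤ (1 / 2 : ℝ) ^ m :=
    pow_le_pow_of_le_one (by norm_num) (by norm_num) (le_trans (by omega) (Nat.self_le_factorial (N + 1)))
  rw [h2] at h1
  linarith

end Summit.Schanuel.Schanuel.Theorems.RootDecomp1KSectorTheorem
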